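import Mathlib
import Literature.AlgebraicGeometry.Resolution.BlowupPrincipalCharts
import Literature.AlgebraicGeometry.Resolution.BlowupChartRatios

/-!
# The vertex locus in a principal chart is a zero locus (equations of the cone-brick centres upstairs)
(crux stmt-ResolutionOfSingularities-15640 `WildQuotients.WildQuotientResolution`, line `Sketch`;
chain w45c programmes V3U/V4U, `L/w45c/CHAIN.md` v7 §4 (scaffolds p496627 / p501160, cone-brick
transfer p503610); [OURS · L1 W4.5c] — generic glue, NOT a statement of any manuscript.)

The cone bricks of the toric exits (`HPa` of `ToricExit.jordanThree_hasResolution_of_bricks`,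
`HP₀`/`HP₁` of `JordanFour.jordanFour_hasResolution_of_bricks`) concern the closed vertex loci
`T = π⁻¹V(F) ∖ ⋃_{j ∈ J} X'[W, y_j]` of a blowing up `π : X' → X` (`F ⊆ Γ(X, W)` the equations of
the fixed locus, `X'[W, y_j]` principal charts), seen inside a stable open `O ⊆ X'[W, u]`; the
cone-brick transfer `BlowupExit.exists_isBlowup_regular_of_invariantsPresentation` (p503610) wants
`O.ι⁻¹ T` as the zero locus `(↥O).zeroLocus 𝔞` of a set of SECTIONS `𝔞 ⊆ Γ(↥O, U')`. This file
supplies `𝔞`: the pulled-back equations `π^*F` and the chart ratios `T_{u y_j} = π^*y_j / π^*u`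
(Literature `BlowupChartRatios`: `D(T_{uv}) = X'[W, u] ∩ X'[W, v]`), restricted to `O`:

* `inter_compl_iSup_blowupChart_eq_zeroLocus` — on `X'[W, u]`, the complement of `⋃_j X'[W, y_j]`
  is the zero locus of the ratios `T_{u y_j}`;
* `inter_preimage_zeroLocus_eq` — on `X'[W, u]`, `π⁻¹V(F) = V(π^*F)`;
* `preimage_ι_zeroLocus_eq` — for an open `O` and `U' = ⊤` of `↥O`, `O.ι⁻¹ V(𝔟) = V(𝔟|_{U'})`;
* `preimage_ι_vertexLocus_eq_zeroLocus` — the combination, in the literal shape consumed by the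
  cone-brick transfer (and `…_spec` for an affine base `X = Spec S`, where the fixed locus is given
  by ring elements, as in the two scaffolds).
-/

-- single-problem summit: the doubled namespace component `ResolutionOfSingularities` is forced
set_option linter.dupNamespace false

noncomputable section

universe u

open CategoryTheory AlgebraicGeometry TopologicalSpace
open Literature.AlgebraicGeometry.Resolution

namespace Summit.ResolutionOfSingularities.ResolutionOfSingularities.Theorems.WildQuotientResolution.BlowupExit

variable {X' X : Scheme.{u}} {π : X' ⟶ X} {I : X.IdealSheafData}

/-- **On `X'[W, u]` the complement of the charts `X'[W, y_j]` is the zero locus of the ratios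
`T_{u y_j}`** (`D(T_{u y_j}) = X'[W, u] ∩ X'[W, y_j]`). [cite: StacksProject, Tag 0804] -/
theorem inter_compl_iSup_blowupChart_eq_zeroLocus (hπ : IsBlowup π I) (W : X.affineOpens)
    {u : Γ(X, W)} (hu : u ∈ I.ideal W) {κ : Type*} (y : κ → Γ(X, W)) (hy : ∀ j, y j ∈ I.ideal W)
    (T : κ → Γ(X', blowupChart π I W u))
    (hT : ∀ j, π.appLE W (blowupChart π I W u) (blowupChart_le_preimage π I W u) (y j) =
      π.appLE W (blowupChart π I W u) (blowupChart_le_preimage π I W u) u * T j) :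
    (blowupChart π I W u : Set X') ∩ ((⨆ j, blowupChart π I W (y j) : X'.Opens) : Set X')ᶜ =
      (blowupChart π I W u : Set X') ∩ X'.zeroLocus (Set.range T) := by
  ext v
  simp only [Set.mem_inter_iff, Set.mem_compl_iff, SetLike.mem_coe, Opens.mem_iSup, not_exists,
    Scheme.mem_zeroLocus_iff, Set.forall_mem_range]
  refine and_congr_right fun hv => forall_congr' fun j => ?_
  rw [hπ.basicOpen_chartRatio W hu (hy j) (hT j), Opens.mem_inf]
  exact ⟨fun h h' => h h'.2, fun h h' => h ⟨hv, h'⟩⟩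

/-- **On `X'[W, u]`, `π⁻¹V(F) = V(π^*F)`** for the pulled-back sections `π^*F ⊆ Γ(X', X'[W, u])`.
[folklore] -/
theorem inter_preimage_zeroLocus_eq (W : X.affineOpens) (u : Γ(X, W)) (F : Set Γ(X, W)) :
    (blowupChart π I W u : Set X') ∩ π.base ⁻¹' X.zeroLocus F =
      (blowupChart π I W u : Set X') ∩ X'.zeroLocus
        ((π.appLE W (blowupChart π I W u) (blowupChart_le_preimage π I W u)) '' F) := by
  ext v
  simp only [Set.mem_inter_iff, Set.mem_preimage, SetLike.mem_coe, Scheme.mem_zeroLocus_iff,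
    Set.forall_mem_image]
  refine and_congr_right fun hv => forall_congr' fun f => forall_congr' fun _ => ?_
  rw [Scheme.basicOpen_appLE, Opens.mem_inf]
  exact ⟨fun h h' => h h'.2, fun h h' => h ⟨hv, h'⟩⟩

/-- **Restriction to an open subscheme**: for an open `O ⊆ X'`, an open `U'` of `↥O` which is
everything, and sections `𝔟 ⊆ Γ(X', V)` over an open `V ⊇ O`, the preimage of `V(𝔟)` in `↥O` is
the zero locus of the restricted sections. [folklore] -/
theorem preimage_ι_zeroLocus_eq (O V : X'.Opens) (U' : (O : Scheme.{u}).Opens) (hU' : U' = ⊤)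
    (hle : U' ≤ O.ι ⁻¹ᵁ V) (𝔟 : Set Γ(X', V)) :
    O.ι.base ⁻¹' X'.zeroLocus 𝔟 = (O : Scheme.{u}).zeroLocus ((O.ι.appLE V U' hle) '' 𝔟) := by
  ext x
  simp only [Set.mem_preimage, Scheme.mem_zeroLocus_iff, Set.forall_mem_image]
  refine forall_congr' fun f => forall_congr' fun _ => ?_
  rw [Scheme.basicOpen_appLE, Opens.mem_inf]
  have hx : x ∈ U' := by rw [hU']; trivial
  exact ⟨fun h h' => h h'.2, fun h h' => h ⟨hx, h'⟩⟩

/-- **The vertex locus seen in a stable piece is a zero locus.** For `O ⊆ X'[W, u]` open, `U'` an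
open of `↥O` which is everything, `F ⊆ Γ(X, W)`, charts `X'[W, y_j]` and ratios `T_j` with
`π^*y_j = π^*u · T_j` on `X'[W, u]`:
`O.ι⁻¹ (π⁻¹V(F) ∖ ⋃_j X'[W, y_j]) = V((π^*F ∪ {T_j})|_{U'})` in `↥O`. [OURS · L1 W4.5c] [folklore] -/
theorem preimage_ι_vertexLocus_eq_zeroLocus (hπ : IsBlowup π I) (W : X.affineOpens)
    {u : Γ(X, W)} (hu : u ∈ I.ideal W) {κ : Type*} (y : κ → Γ(X, W)) (hy : ∀ j, y j ∈ I.ideal W)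
    (T : κ → Γ(X', blowupChart π I W u))
    (hT : ∀ j, π.appLE W (blowupChart π I W u) (blowupChart_le_preimage π I W u) (y j) =
      π.appLE W (blowupChart π I W u) (blowupChart_le_preimage π I W u) u * T j)
    (F : Set Γ(X, W)) (O : X'.Opens) (hO : O ≤ blowupChart π I W u)
    (U' : (O : Scheme.{u}).Opens) (hU' : U' = ⊤) (hle : U' ≤ O.ι ⁻¹ᵁ blowupChart π I W u) :
    O.ι.base ⁻¹' (π.base ⁻¹' X.zeroLocus F \ ((⨆ j, blowupChart π I W (y j) : X'.Opens) : Set X')) =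
      (O : Scheme.{u}).zeroLocus ((O.ι.appLE (blowupChart π I W u) U' hle) ''
        ((π.appLE W (blowupChart π I W u) (blowupChart_le_preimage π I W u)) '' F ∪ Set.range T)) := by
  classical
  ext x
  have hxO : O.ι.base x ∈ (O : Set X') := by
    rw [← Scheme.Opens.range_ι]; exact ⟨x, rfl⟩
  have hxu : O.ι.base x ∈ (blowupChart π I W u : Set X') := hO hxO
  have h1 := Set.ext_iff.mp (inter_compl_iSup_blowupChart_eq_zeroLocus hπ W hu y hy T hT) (O.ι.base x)
  have h2 := Set.ext_iff.mp (inter_preimage_zeroLocus_eq (π := π) (I := I) W u F) (O.ι.base x)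
  have h3 := Set.ext_iff.mp (preimage_ι_zeroLocus_eq O (blowupChart π I W u) U' hU' hle
    ((π.appLE W (blowupChart π I W u) (blowupChart_le_preimage π I W u)) '' F ∪ Set.range T)) x
  simp only [Set.mem_inter_iff, Set.mem_compl_iff, Set.mem_preimage] at h1 h2
  rw [← h3]
  simp only [Set.mem_preimage, Set.mem_sdiff]
  have hzu : ∀ v : X', v ∈ X'.zeroLocus ((π.appLE W (blowupChart π I W u)
      (blowupChart_le_preimage π I W u)) '' F ∪ Set.range T) ↔
      v ∈ X'.zeroLocus ((π.appLE W (blowupChart π I W u) (blowupChart_le_preimage π I W u)) '' F) ∧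
        v ∈ X'.zeroLocus (Set.range T) := by
    intro v
    simp only [Scheme.mem_zeroLocus_iff, Set.mem_union, or_imp, forall_and]
  rw [hzu]
  constructor
  · rintro ⟨hF, hU⟩
    exact ⟨(h2.mp ⟨hxu, hF⟩).2, (h1.mp ⟨hxu, hU⟩).2⟩
  · rintro ⟨hF, hT'⟩
    exact ⟨(h2.mpr ⟨hxu, hF⟩).2, (h1.mpr ⟨hxu, hT'⟩).2⟩

/-- **The same over an affine base `X = Spec S` with the fixed locus given by ring elements**
(`{v | π v ∈ V(F₀)}`, `F₀ ⊆ S`, as in the scaffolds p496627 / p501160: the sections are the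
`(ΓSpecIso S)⁻¹ f`, `f ∈ F₀`). [OURS · L1 W4.5c] [folklore] -/
theorem preimage_ι_vertexLocus_eq_zeroLocus_spec {S : Type} [CommRing S] {X' : Scheme.{0}}
    {π : X' ⟶ Spec (CommRingCat.of S)} {I : (Spec (CommRingCat.of S)).IdealSheafData}
    (hπ : IsBlowup π I) {u : Γ(Spec (CommRingCat.of S), ⊤)}
    (hu : u ∈ I.ideal ⟨⊤, isAffineOpen_top _⟩) {κ : Type*} (y : κ → Γ(Spec (CommRingCat.of S), ⊤))
    (hy : ∀ j, y j ∈ I.ideal ⟨⊤, isAffineOpen_top _⟩)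
    (T : κ → Γ(X', blowupChart π I ⟨⊤, isAffineOpen_top _⟩ u))
    (hT : ∀ j, π.appLE ⊤ (blowupChart π I ⟨⊤, isAffineOpen_top _⟩ u)
        (blowupChart_le_preimage π I ⟨⊤, isAffineOpen_top _⟩ u) (y j) =
      π.appLE ⊤ (blowupChart π I ⟨⊤, isAffineOpen_top _⟩ u)
        (blowupChart_le_preimage π I ⟨⊤, isAffineOpen_top _⟩ u) u * T j)
    (F₀ : Set S) (O : X'.Opens) (hO : O ≤ blowupChart π I ⟨⊤, isAffineOpen_top _⟩ u)
    (U' : (O : Scheme.{0}).Opens) (hU' : U' = ⊤)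
    (hle : U' ≤ O.ι ⁻¹ᵁ blowupChart π I ⟨⊤, isAffineOpen_top _⟩ u) :
    O.ι.base ⁻¹' ({v | π.base v ∈ PrimeSpectrum.zeroLocus F₀} \
        ((⨆ j, blowupChart π I ⟨⊤, isAffineOpen_top _⟩ (y j) : X'.Opens) : Set X')) =
      (O : Scheme.{0}).zeroLocus ((O.ι.appLE (blowupChart π I ⟨⊤, isAffineOpen_top _⟩ u) U' hle) ''
        ((π.appLE ⊤ (blowupChart π I ⟨⊤, isAffineOpen_top _⟩ u)
          (blowupChart_le_preimage π I ⟨⊤, isAffineOpen_top _⟩ u)) ''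
            ((Scheme.ΓSpecIso (CommRingCat.of S)).inv '' F₀) ∪ Set.range T)) := by
  have hF : {v : X' | π.base v ∈ PrimeSpectrum.zeroLocus F₀} =
      π.base ⁻¹' (Spec (CommRingCat.of S)).zeroLocus
        ((Scheme.ΓSpecIso (CommRingCat.of S)).inv '' F₀) := by
    rw [AlgebraicGeometry.Spec_zeroLocus_eq_zeroLocus]
    rfl
  rw [hF]
  exact preimage_ι_vertexLocus_eq_zeroLocus hπ ⟨⊤, isAffineOpen_top _⟩ hu y hy T hT _ O hO U' hU' hle

end Summit.ResolutionOfSingularities.ResolutionOfSingularities.Theorems.WildQuotientResolution.BlowupExit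

end
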